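import Summits.BirchSwinnertonDyer.BirchSwinnertonDyer.Theorems.ClassRecordThreeEulerHalvesAtThreeCartanSupplyConvolution
import HarnessLib

/-!
# SUPPLY from PERMUTATION MODELS, VIII — the last input as PURE CHARACTER SUMS (no `cosetPerm`, no `Fin`)

Helper file riding `--supports stmt-BirchSwinnertonDyer-19109` (crux `EulerHalvesAtThree`; UNREGISTERED sub-line `Cruxes/EulerHalvesAtThree/Lines/cartan_corr`,
seat `bsd-idea-10` g12), continuing `…CartanSupplyConvolution`. The convolution identity (β) of file VII counts fixed points of `gh` on the opaque numbering
`Fin [G:T]` (`cosetPerm`). This file removes the numbering: `#{y ∈ G | y⁻¹xy ∈ T} = |T|·#Fix(x | G∕T)` (`card_conj_mem_eq_mul_fixed`, from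
`QuotientGroup.preimageMkEquivSubgroupProdSet` and `x·yT = yT ⟺ y⁻¹xy ∈ T`), so (β) follows from (β′) `χ(1)·Σ_h χ(h)·#{y ∈ G | y⁻¹(gh)y ∈ T} = N·|T|·χ(g)`
(`convolution_of_conjCount`). NET: `CartanCharacterSumSupply` — per prime `q ∉ {2,3}`, in the TREE'S torus language (`splitTorus q`, `nonsplitTorus η`,
`cubicNewvectorChar q`): (α) `χ_W(1)·Σ_h χ_W(h)χ_W(h⁻¹k) = |GL₂(𝔽_q)|·χ_W(k)` and (β′) `χ_W(1)·Σ_h χ_W(h)·#{y | y⁻¹(gh)y ∈ T} = |GL₂(𝔽_q)|·|T|·χ_W(g)` with `T = T_s`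
(`q ≡ 1 (3)`) ∕ `T = T_C(η)` for some elliptic `η` (`q ≡ 2 (3)`) — nothing but finite sums of the class function `χ_W` over `GL₂(𝔽_q)` and a torus;
`cartanTorusLatticeSupply_of_characterSumSupply : CartanCharacterSumSupply → CartanTorusLatticeSupply` (SUPPLY, the v11 stub of 23422's line `cartan`, BY NAME).
Remark for the prover: `Σ_h χ(h)·#{y | y⁻¹ghy ∈ T} = Σ_{y∈G} Σ_{t∈T} χ(g⁻¹·yty⁻¹)` (substitute `h = g⁻¹yty⁻¹`), so (β′) is Frobenius reciprocity
`⟨χ_W, Ind_T^G 1⟩ = 1` in disguise once (α) makes `χ_W∕‖χ_W‖` an idempotent. HONEST FRAMING: reductions only; (α), (β′), SUPPLY, NUM, (F2b♭), the cruxes are NOT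
proved; BSD is proved for no curve. [folklore]
-/

set_option linter.dupNamespace false
set_option autoImplicit false

namespace Summit.BirchSwinnertonDyer.BirchSwinnertonDyer.Theorems.CartanSupply

open Summit.BirchSwinnertonDyer.BirchSwinnertonDyer.Theorems.CartanDegree
open Summit.BirchSwinnertonDyer.BirchSwinnertonDyer.Theorems.CartanTorusCubeCut
open Summit.BirchSwinnertonDyer.BirchSwinnertonDyer.Theorems.CartanCorrespondence
open scoped Classical

/-! ## §1 Generic: conjugation count = `|T|` × fixed points -/

section general
variable {G : Type*} [Group G] [Fintype G] (T : Subgroup G)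

/-- PROVED: `#{y ∈ G | y⁻¹xy ∈ T} = |T| · #Fix(x | G∕T)`. [folklore] -/
theorem card_conj_mem_eq_mul_fixed (x : G) :
    (Finset.univ.filter fun y : G => y⁻¹ * x * y ∈ T).card =
      Nat.card T * (Finset.univ.filter fun i : Fin (Nat.card (G ⧸ T)) => cosetPerm T x i = i).card := by
  have h1 : Nat.card (QuotientGroup.mk ⁻¹' {c : G ⧸ T | x • c = c}) = Nat.card T * Nat.card {c : G ⧸ T | x • c = c} := by
    rw [Nat.card_congr (QuotientGroup.preimageMkEquivSubgroupProdSet T _), Nat.card_prod]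
  have h2 : Nat.card (QuotientGroup.mk ⁻¹' {c : G ⧸ T | x • c = c}) = Nat.card {y : G // y⁻¹ * x * y ∈ T} := by
    refine Nat.card_congr (Equiv.subtypeEquivRight (fun y => ?_))
    rw [Set.mem_preimage, Set.mem_setOf_eq, MulAction.Quotient.smul_mk, smul_eq_mul, eq_comm, QuotientGroup.eq, mul_assoc]
  have h3 : Nat.card {c : G ⧸ T | x • c = c} = Nat.card {i : Fin (Nat.card (G ⧸ T)) // cosetPerm T x i = i} := by
    refine Nat.card_congr (Equiv.subtypeEquiv (cosetEquiv T) (fun c => ?_))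
    rw [Set.mem_setOf_eq, cosetPerm_apply, Equiv.symm_apply_apply, Equiv.apply_eq_iff_eq]
  have h4 : Nat.card {y : G // y⁻¹ * x * y ∈ T} = (Finset.univ.filter fun y : G => y⁻¹ * x * y ∈ T).card := by
    rw [Nat.card_eq_fintype_card, Fintype.card_subtype]
  have h5 : Nat.card {i : Fin (Nat.card (G ⧸ T)) // cosetPerm T x i = i} =
      (Finset.univ.filter fun i : Fin (Nat.card (G ⧸ T)) => cosetPerm T x i = i).card := by
    rw [Nat.card_eq_fintype_card, Fintype.card_subtype]
  rw [← h4, ← h2, h1, h3, h5]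

/-- PROVED: (β′) with the conjugation count implies (β) with the fixed-point count. [folklore] -/
theorem convolution_of_conjCount (χ : G → ℤ) (g : G)
    (h : χ 1 * ∑ k : G, χ k * ((Finset.univ.filter fun y : G => y⁻¹ * (g * k) * y ∈ T).card : ℤ) =
      Fintype.card G * Nat.card T * χ g) :
    χ 1 * ∑ k : G, χ k * ((Finset.univ.filter fun i : Fin (Nat.card (G ⧸ T)) => cosetPerm T (g * k) i = i).card : ℤ) =
      Fintype.card G * χ g := by
  have hT : (Nat.card T : ℤ) ≠ 0 := by exact_mod_cast (Nat.card_pos (α := T)).ne'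
  have e : ∀ k : G, (((Finset.univ.filter fun y : G => y⁻¹ * (g * k) * y ∈ T).card : ℕ) : ℤ) =
      (Nat.card T : ℤ) * ((Finset.univ.filter fun i : Fin (Nat.card (G ⧸ T)) => cosetPerm T (g * k) i = i).card : ℤ) := by
    intro k
    rw [card_conj_mem_eq_mul_fixed T (g * k), Nat.cast_mul]
  simp only [e] at h
  have key : χ 1 * ∑ k : G, χ k * ((Nat.card T : ℤ) *
      ((Finset.univ.filter fun i : Fin (Nat.card (G ⧸ T)) => cosetPerm T (g * k) i = i).card : ℤ)) =
      (Nat.card T : ℤ) * (χ 1 * ∑ k : G, χ k *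
      ((Finset.univ.filter fun i : Fin (Nat.card (G ⧸ T)) => cosetPerm T (g * k) i = i).card : ℤ)) := by
    rw [Finset.mul_sum, Finset.mul_sum, Finset.mul_sum]
    exact Finset.sum_congr rfl (fun k _ => by ring)
  rw [key] at h
  apply mul_left_cancel₀ hT
  rw [h]
  ring

end general

/-! ## §2 `GL₂(𝔽_q)`: the character-sum supply and SUPPLY by name -/

variable {q : ℕ} [Fact q.Prime]

/-- **CHARACTER-SUM SUPPLY**: per prime `q ∉ {2, 3}`, in the tree's torus language — (α) `χ_W(1)·Σ_h χ_W(h)χ_W(h⁻¹k) = |G|·χ_W(k)`; (β′) `χ_W(1)·Σ_h χ_W(h)·#{y | y⁻¹(gh)y ∈ T}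
= |G|·|T|·χ_W(g)` with `T = splitTorus q` (`q ≡ 1 (3)`) ∕ `T = nonsplitTorus η`, some elliptic `η` (`q ≡ 2 (3)`). Finite sums of `cubicNewvectorChar` only. [folklore] -/
@[conjecture]
def CartanCharacterSumSupply : Prop := ∀ q : ℕ, ∀ _hq : Fact q.Prime, q ≠ 3 → q ≠ 2 →
  (∀ k : G q, cubicNewvectorChar q 1 * ∑ h : G q, cubicNewvectorChar q h * cubicNewvectorChar q (h⁻¹ * k) =
      Fintype.card (G q) * cubicNewvectorChar q k) ∧
  (q % 3 = 1 → ∀ g : G q, cubicNewvectorChar q 1 * ∑ h : G q, cubicNewvectorChar q h *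
      ((Finset.univ.filter fun y : G q => y⁻¹ * (g * h) * y ∈ splitTorus q).card : ℤ) =
      Fintype.card (G q) * (splitTorus q).card * cubicNewvectorChar q g) ∧
  (q % 3 = 2 → ∃ η : Mat q, ¬ HasRatEigenvalue η ∧ ∀ g : G q, cubicNewvectorChar q 1 * ∑ h : G q, cubicNewvectorChar q h *
      ((Finset.univ.filter fun y : G q => y⁻¹ * (g * h) * y ∈ nonsplitTorus η).card : ℤ) =
      Fintype.card (G q) * (nonsplitTorus η).card * cubicNewvectorChar q g)

/-- PROVED: the split-torus count in the two languages. [folklore] -/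
theorem filter_conj_splitTorus (x : G q) :
    (Finset.univ.filter fun y : G q => y⁻¹ * x * y ∈ splitTorus q) = (Finset.univ.filter fun y : G q => y⁻¹ * x * y ∈ splitTorusSub q) := by
  refine Finset.filter_congr (fun y _ => ?_)
  show y⁻¹ * x * y ∈ splitTorus q ↔ ((y⁻¹ * x * y : G q) : Mat q) 0 1 = 0 ∧ ((y⁻¹ * x * y : G q) : Mat q) 1 0 = 0
  simp [splitTorus]

/-- PROVED: the non-split-torus count in the two languages. [folklore] -/
theorem filter_conj_nonsplitTorus (η : Mat q) (x : G q) :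
    (Finset.univ.filter fun y : G q => y⁻¹ * x * y ∈ nonsplitTorus η) = (Finset.univ.filter fun y : G q => y⁻¹ * x * y ∈ centralizerSub η) := by
  refine Finset.filter_congr (fun y _ => ?_)
  show y⁻¹ * x * y ∈ nonsplitTorus η ↔ ((y⁻¹ * x * y : G q) : Mat q) * η = η * ((y⁻¹ * x * y : G q) : Mat q)
  simp [nonsplitTorus]

omit [Fact q.Prime] in
/-- PROVED — **CONVOLUTION SUPPLY ⟸ CHARACTER-SUM SUPPLY**. [folklore] -/
theorem cartanConvolutionSupply_of_characterSumSupply (h : CartanCharacterSumSupply) : CartanConvolutionSupply := by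
  intro q hq h3 hq2
  obtain ⟨hα, hβs, hβc⟩ := h q hq h3 hq2
  refine ⟨hα, fun h1 g => ?_, fun h2 => ?_⟩
  · apply convolution_of_conjCount (splitTorusSub q) (cubicNewvectorChar q) g
    have hc : ((splitTorus q).card : ℤ) = (Nat.card (splitTorusSub q) : ℤ) := by rw [splitTorus_card, card_splitTorusSub]
    have := hβs h1 g
    simp only [filter_conj_splitTorus, hc] at this
    exact this
  · obtain ⟨η, hη, hβ⟩ := hβc h2
    refine ⟨η, hη, fun g => ?_⟩
    apply convolution_of_conjCount (centralizerSub η) (cubicNewvectorChar q) g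
    have hc : ((nonsplitTorus η).card : ℤ) = (Nat.card (centralizerSub η) : ℤ) := by rw [nonsplitTorus_card hη, card_centralizerSub hη]
    have := hβ g
    simp only [filter_conj_nonsplitTorus, hc] at this
    exact this

omit [Fact q.Prime] in
/-- PROVED — **SUPPLY ⟸ CHARACTER-SUM SUPPLY** (`CartanTorusLatticeSupply`, the v11 stub of line `cartan`, BY NAME). [folklore] -/
theorem cartanTorusLatticeSupply_of_characterSumSupply (h : CartanCharacterSumSupply) : CartanTorusLatticeSupply :=
  cartanTorusLatticeSupply_of_convolutionSupply (cartanConvolutionSupply_of_characterSumSupply h)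

end Summit.BirchSwinnertonDyer.BirchSwinnertonDyer.Theorems.CartanSupply
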